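import Literature.AlgebraicGeometry.Resolution.NormalizationOfVarietiesProofs
import Mathlib.RingTheory.Localization.Integral
import Mathlib.RingTheory.Localization.Finiteness
import Mathlib.RingTheory.Localization.LocalizationLocalization
import Mathlib.AlgebraicGeometry.Morphisms.FiniteType
import Mathlib.AlgebraicGeometry.FunctionField
import Mathlib.AlgebraicGeometry.AffineScheme
import HarnessLib

/-!
# Finiteness of the normalisation of the local rings of a variety (E. Noether + localisation)
# (crux `FInjectiveMacaulayfication` stmt-ResolutionOfSingularities-15315, chain w45a, plan-1 R13.14 (3): discharge of `hfin`)

[OURS · L1 W4.5a · res-D-pv-019 AS res-L1-w45a-stub-7] Support file (`--supports stmt-ResolutionOfSingularities-15315 --as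
helper`) for the crux `FrobeniusLadder.FInjectiveMacaulayfication`; NOT a statement of any manuscript; AI-written, weaker than
expert review.

The hypothesis `hfin : Module.Finite 𝒪 (integralClosure 𝒪 (Frac 𝒪))` of `PointFixDimOne.pointFix_of_dim_one` /
`PointFixDimOne.h4Loc_of_dim_one` («5e in dimension one») holds for every local ring `𝒪 = 𝒪_{X,b}` of a scheme `X` integral and
locally of finite type over a field `k`:

* `module_finite_integralClosure_of_isLocalization` — ring level: for a domain `R` of finite type over a field `k` and a
  localisation `R_M` (`M ⊆ R ∖ 0`), the integral closure of `R_M` in `Frac R_M` is a finite `R_M`-module. PROOF: `Frac R_M = Frac R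
  =: K`; the integral closure `N` of `R` in `K` is finite over `R` (E. NOETHER, the tree's PROVED `NoetherFiniteIntegralClosure_holds`,
  Liu 2002 Prop. 4.1.27); integral closure commutes with localisation (Mathlib `IsLocalization.integralClosure`): the integral
  closure of `R_M` in `K` is `N_M`, finite over `R_M` (`Module.Finite.of_isLocalization`).
* `module_finite_integralClosure_stalk` — scheme level: `𝒪_{X,b}` is the localisation of the finite-type `k`-domain `Γ(X, U)`
  (`U ∋ b` affine) at the prime of `b` (Mathlib `IsAffineOpen.isLocalization_stalk`).
No sorry, no definitions, no named facts.
-/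

-- single-problem summit: the doubled namespace component is forced
set_option linter.dupNamespace false

noncomputable section

open AlgebraicGeometry CategoryTheory Literature.AlgebraicGeometry.Resolution

namespace Summit.ResolutionOfSingularities.ResolutionOfSingularities.Theorems.FInjectiveMacaulayfication.StalkNormalizationFinite

/-- The fraction field of a localisation `R_M` (`M ⊆ R ∖ 0`) of a domain `R` is a fraction field of `R` (localisation of a
localisation). [folklore] -/
theorem isFractionRing_of_isLocalization_of_le {R Rp K : Type} [CommRing R] [IsDomain R] (M : Submonoid R)
    (hM : M ≤ nonZeroDivisors R) [CommRing Rp] [IsDomain Rp] [Algebra R Rp] [IsLocalization M Rp] [CommRing K]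
    [Algebra Rp K] [IsFractionRing Rp K] [Algebra R K] [IsScalarTower R Rp K] : IsFractionRing R K := by
  have h := IsLocalization.localization_localization_isLocalization_of_has_all_units M (nonZeroDivisors Rp) K
    fun x hx => hx.mem_nonZeroDivisors
  have heq : (nonZeroDivisors Rp).comap (algebraMap R Rp) = nonZeroDivisors R := by
    ext r
    simp only [Submonoid.mem_comap, mem_nonZeroDivisors_iff_ne_zero]
    exact map_ne_zero_iff _ (IsLocalization.injective Rp hM)
  rw [heq] at h
  exact h

/-- **E. Noether + localisation.** For a domain `R` of finite type over a field `k`, `M ⊆ R ∖ 0` and a localisation `R_M`, the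
integral closure of `R_M` in its fraction field is a finite `R_M`-module. [cite: Liu2002, Prop. 4.1.27, p. 122] -/
theorem module_finite_integralClosure_of_isLocalization (k R Rp : Type) [Field k] [CommRing R] [IsDomain R] [Algebra k R]
    [Algebra.FiniteType k R] (M : Submonoid R) (hM : M ≤ nonZeroDivisors R) [CommRing Rp] [IsDomain Rp] [Algebra R Rp]
    [IsLocalization M Rp] : Module.Finite Rp (integralClosure Rp (FractionRing Rp)) := by
  -- `K := Frac R_M` is a fraction field of `R`
  haveI : IsFractionRing R (FractionRing Rp) := isFractionRing_of_isLocalization_of_le (Rp := Rp) M hM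
  -- E. Noether: the integral closure `N` of `R` in `K` is finite over `R`
  haveI : Module.Finite R (integralClosure R (FractionRing Rp)) :=
    NoetherFiniteIntegralClosure_holds.self k R (FractionRing Rp)
  -- the inclusion `N ⊆ N' :=` integral closure of `R_M` in `K`
  let ι : integralClosure R (FractionRing Rp) →+* integralClosure Rp (FractionRing Rp) :=
    { toFun := fun x => ⟨x.1, IsIntegral.tower_top (A := Rp) (show IsIntegral R x.1 from x.2)⟩
      map_one' := rfl
      map_mul' := fun _ _ => rfl
      map_zero' := rfl
      map_add' := fun _ _ => rfl }
  letI : Algebra (integralClosure R (FractionRing Rp)) (integralClosure Rp (FractionRing Rp)) := ι.toAlgebra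
  haveI : IsScalarTower (integralClosure R (FractionRing Rp)) (integralClosure Rp (FractionRing Rp)) (FractionRing Rp) :=
    IsScalarTower.of_algebraMap_eq fun _ => rfl
  haveI : IsScalarTower R (integralClosure R (FractionRing Rp)) (integralClosure Rp (FractionRing Rp)) :=
    IsScalarTower.of_algebraMap_eq fun _ => Subtype.ext rfl
  -- `K` is its own localisation at the image of `M` (nonzero elements are units)
  haveI : IsLocalization (Algebra.algebraMapSubmonoid (FractionRing Rp) M) (FractionRing Rp) := by
    refine IsLocalization.of_le_isUnit ?_
    rintro _ ⟨m, hm, rfl⟩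
    rw [IsUnit.mem_submonoid_iff, isUnit_iff_ne_zero]
    exact IsFractionRing.to_map_ne_zero_of_mem_nonZeroDivisors (hM hm)
  -- integral closure commutes with localisation: `N' = N_M`
  haveI := IsLocalization.integralClosure (R := R) (S := FractionRing Rp) (Rf := Rp) (Sf := FractionRing Rp) M
  exact Module.Finite.of_isLocalization R (integralClosure R (FractionRing Rp)) M

/-- **The normalisation of a local ring of a variety is finite.** For `X` integral and locally of finite type over a field `k` and
`b ∈ X`, the integral closure of `𝒪_{X,b}` in its fraction field is a finite `𝒪_{X,b}`-module (`𝒪_{X,b} = Γ(X, U)_𝔭` for an affine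
open `U ∋ b`; `module_finite_integralClosure_of_isLocalization`). [cite: Liu2002, Prop. 4.1.27, p. 122] -/
theorem module_finite_integralClosure_stalk (k : Type) [Field k] (X : Scheme.{0}) (f : X ⟶ Spec (.of k))
    [LocallyOfFiniteType f] [IsIntegral X] (b : X) :
    Module.Finite (X.presheaf.stalk b) (integralClosure (X.presheaf.stalk b) (FractionRing (X.presheaf.stalk b))) := by
  obtain ⟨_, ⟨U, hU, rfl⟩, hbU, -⟩ := X.isBasis_affineOpens.exists_subset_of_mem_open (Set.mem_univ b) isOpen_univ
  haveI : Nonempty (U : X.Opens) := ⟨⟨b, hbU⟩⟩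
  -- `Γ(X, U)` is a `k`-algebra of finite type (adapted from `FiLocusOpenOfAffine.finiteType_sections`)
  have h1 : (f.appLE ⊤ U le_top).hom.FiniteType := f.finiteType_appLE (isAffineOpen_top _) hU le_top
  have h2 : (Scheme.ΓSpecIso (.of k)).inv.hom.FiniteType :=
    RingHom.FiniteType.of_surjective _ (Scheme.ΓSpecIso (.of k)).symm.commRingCatIsoToRingEquiv.surjective
  letI : Algebra k Γ(X, U) := ((f.appLE ⊤ U le_top).hom.comp (Scheme.ΓSpecIso (.of k)).inv.hom).toAlgebra
  haveI : Algebra.FiniteType k Γ(X, U) := h1.comp h2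
  -- `𝒪_{X,b} = Γ(X, U)_𝔭`
  letI := TopCat.Presheaf.algebra_section_stalk X.presheaf (⟨b, hbU⟩ : U)
  haveI : IsLocalization.AtPrime (X.presheaf.stalk b) (hU.primeIdealOf ⟨b, hbU⟩).asIdeal := hU.isLocalization_stalk ⟨b, hbU⟩
  exact module_finite_integralClosure_of_isLocalization k Γ(X, U) (X.presheaf.stalk b)
    (hU.primeIdealOf ⟨b, hbU⟩).asIdeal.primeCompl (Ideal.primeCompl_le_nonZeroDivisors _)

end Summit.ResolutionOfSingularities.ResolutionOfSingularities.Theorems.FInjectiveMacaulayfication.StalkNormalizationFinite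

end
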